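import Mathlib.Analysis.SpecificLimits.Basic
import Summits.Ventures.CertifiedArithmetic.LowPrec.GemmThetaLawMixAFamily
import Summits.Ventures.CertifiedArithmetic.LowPrec.GemmThetaLawGenBinary32
import Summits.Ventures.CertifiedArithmetic.LowPrec.GemmWorstCaseE2M1
import HarnessLib

/-!
# GEMM worst case LIV — `W_p(n)` for E2M3·E2M1 (FP6·FP4) into EVERY precision `p ≥ 10`: the
# two-sided sandwich `θ_p/(n - 1 + θ_p(97/2 + κ_p)) ≤ 1 - W_p(n) ≤ θ_p/(n - c_p)` and the
# limit `n(1 - W_p(n)) → θ_p`, kernel-checked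

HONEST FRAMING: certified error envelopes and provably optimal rounding/accumulation schemes for
low-precision formats under stated cost models; every table by two implementations; no hardware or
vendor claims.

`W_φ(n)` (`worstRelErrMixA φ (n-1)`) is the largest relative error `|ŝ - s|/Σ|x_i|` of
sequential round-to-nearest-even accumulation in the format `φ` over ALL words of `n` letters
from the 165-letter mixed product alphabet `Λ(E2M3·E2M1)/2^4` of the generated law
`e2m3e2m1Law` (`GemmThetaLawGenMixAData`; every product of an E2M3 and an E2M1 datum is such a
letter, `mul_mem_PiL_e2m3e2m1` of `GemmThetaLawGenBinary32`) — a finite maximum.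
For every format `φ` with `9 ≤ manBits φ` (`p ≥ 10`), `qexp φ ≤ -4` and
`2^(manBits φ + 12) ≤ maxRat φ` (binary32, binary64, …), with the law's constants
`θ_p = e2m3e2m1Law.thetaL (manBits φ) = (23·2^manBits + 32)/480`,
`κ_p = 256/(15·2^manBits + 16)` (`e2m3e2m1Law_constants`) and `K = 2^(p-8)`
(`2^manBits = 128K`, `θ_p = (184K + 2)/30`):

* `worst4P_le` (SUP side, every `n`): `W_φ(n) ≤ 1 - θ_p/(n - 1 + θ_p(1 + 95/2 + κ_p))` —
  the generated law certificate `thetaCert_e2m3e2m1Law` (`GemmThetaLawGenFinal`) through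
  `ThetaCertificate.abs_err_le` (`ρ = 31/2 ≤ β_pair = 95/2`);
* `one_sub_worst4P_le` (the family of file LIII, every `n ≥ 1089K + 1`, every `p ≥ 8`):
  `1 - W_φ(n) ≤ (184K + 2)/(30n - 28482K + 3) = θ_p/(n - c_p)`, `c_p = (28482K - 3)/30`;
* `worst4P_sandwich`: both at once — the E2M3·E2M1 row of gemm.tex Thm. `t:thetapmix` for
  every `p ≥ 10`, with onset `m_p = 1089K + 1 = 17·2^(p-2) + 2^(p-8) + 1`;
* `worst4P_tendsto`: `n·(1 - W_φ(n)) → θ_p` (in `ℝ`, by the sandwich);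
* `worst4P_sandwich_Binary32`: the instance `p = 24` in integers —
  `31610968560982/(78643210n + 1533131960877089) ≤ 1 - W_24(n) ≤ 4019542/(10n - 622198783)`
  for every `n ≥ 71368705` (the left side agrees with `abs_dot_err_le_e2m3e2m1_Binary32`).

What is NOT claimed: the exact value of `W_p(n)` between the two sides; `p ∈ {8, 9}` (the
family of file LIII is valid there, but the law certificate needs `p ≥ 10`; bfloat16, `p = 8`,
is settled for every `n` in `GemmThetaLawMix`).  References: [Higham2002, §4.2],
[MullerEtAl2018HFPA, §6.1], [BoldoMelquiond2011Flocq]; [RouhaniEtAl2023MX, Table 1].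
-/

namespace Summit.Ventures.CertifiedArithmetic.LowPrec.Gemm

open Literature.ComputerArithmetic.FloatingPoint
open Literature.ComputerArithmetic.FloatingPoint.MiniFloat
open Literature.ComputerArithmetic.FloatingPoint.MiniFloat.ThetaLaw
open Finset

/-! ### `W_φ(n)` over the mixed alphabet, any target format -/

/-- The law's alphabet `Λ(E2M3·E2M1)` has `165 = 1 + 2·82` grid integers. [cell, kernel] -/
theorem lamMixA_length : e2m3e2m1Law.lam.length = 165 := by decide +kernel

/-- THE INPUT SPELLED BY A WORD `w : Fin (m+1) → Fin 165` (letters `Λ/2^4` by index; `0` after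
position `m`). [cell, gemm.tex §Model] -/
def wordInputMixA {m : ℕ} (w : Fin (m + 1) → Fin 165) : ℕ → ℚ :=
  fun j => if h : j < m + 1 then
      ((e2m3e2m1Law.lam[(w ⟨j, h⟩).val]'(by rw [lamMixA_length]; exact (w _).isLt) : ℤ) : ℚ)
        / 2 ^ 4
    else 0

/-- Every term of a word input is a letter of the law. [cell] -/
theorem wordInputMixA_mem {m : ℕ} (w : Fin (m + 1) → Fin 165) (j : ℕ) :
    e2m3e2m1Law.PiL 4 (wordInputMixA w j) := by
  unfold wordInputMixA
  split_ifs
  · exact ⟨_, List.getElem_mem _, rfl⟩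
  · exact ⟨0, by decide, by norm_num⟩

/-- `W_φ(n)` for `n = m + 1`: the largest relative error of sequential RNE accumulation in `φ`
over all words of `n` letters from `Λ(E2M3·E2M1)/2^4`. [cell, gemm.tex §Regimes] -/
def worstRelErrMixA (φ : Format) (m : ℕ) : ℚ :=
  (univ : Finset (Fin (m + 1) → Fin 165)).sup' univ_nonempty
    (fun w => relErr φ (wordInputMixA w) m)

/-- Every input over the alphabet is dominated by `W_φ`. [folklore] -/
theorem relErr_le_worst4P (φ : Format) (x : ℕ → ℚ) (hx : ∀ j, e2m3e2m1Law.PiL 4 (x j))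
    (m : ℕ) : relErr φ x m ≤ worstRelErrMixA φ m := by
  classical
  have hidx : ∀ j, ∃ i : Fin 165, ∀ h : i.val < e2m3e2m1Law.lam.length,
      ((e2m3e2m1Law.lam[i.val]'h : ℤ) : ℚ) / 2 ^ 4 = x j := by
    intro j
    obtain ⟨z, hz, hxz⟩ := hx j
    obtain ⟨i, hi, h⟩ := List.getElem_of_mem hz
    exact ⟨⟨i, by simpa [lamMixA_length] using hi⟩, fun _ => by rw [hxz, ← h]⟩
  choose f hf using hidx
  have hxy : ∀ j ≤ m, x j = wordInputMixA (fun j : Fin (m + 1) => f j.val) j := by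
    intro j hj
    unfold wordInputMixA
    rw [dif_pos (by omega)]
    exact (hf j _).symm
  rw [relErr_congr φ hxy]
  exact le_sup' (fun w => relErr φ (wordInputMixA w) m) (mem_univ _)

/-! ### The law's constants for every precision -/

/-- THE CONSTANTS OF THE E2M3·E2M1 LAW AT EVERY `m = manBits`: `θ = (23·2^m + 32)/480`,
`κ = 256/(15·2^m + 16)`, `ρ = 31/2`, `β_pair = 95/2`. [cell, gemm.tex Thm. t:thetapmix] -/
theorem e2m3e2m1Law_constants (mb : ℕ) :
    e2m3e2m1Law.thetaL mb = (23 * 2 ^ mb + 32) / 480 ∧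
    e2m3e2m1Law.kappaL mb = 256 / (15 * 2 ^ mb + 16) ∧
    e2m3e2m1Law.rhoL = 31 / 2 ∧ e2m3e2m1Law.betaL = 95 / 2 := by
  have hB : e2m3e2m1Law.Bj 8 = 15 := by decide
  have hS : e2m3e2m1Law.Sj 8 = 16 := by decide
  simp only [LawData.thetaL, LawData.kappaL, LawData.rhoL, LawData.betaL,
    show e2m3e2m1Law.kb = 8 from rfl, hB, hS, show e2m3e2m1Law.th1 = 23 from rfl,
    show e2m3e2m1Law.th0 = 32 from rfl, show e2m3e2m1Law.thD = 480 from rfl,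
    show e2m3e2m1Law.rhoN = 31 from rfl, show e2m3e2m1Law.rhoD = 2 from rfl,
    show e2m3e2m1Law.betaN = 95 from rfl, show e2m3e2m1Law.betaD = 2 from rfl]
  norm_num

/-- With `K = 2^(p-8)` (`2^manBits = 128K`): `θ_p = (184K + 2)/30`. [gemm.tex Thm. t:thetapmix] -/
theorem thetaL4_eq {φ : Format} {K : ℕ} (hM : 2 ^ φ.manBits = 128 * K) :
    e2m3e2m1Law.thetaL φ.manBits = (184 * (K : ℚ) + 2) / 30 := by
  have hM' : ((2 ^ φ.manBits : ℕ) : ℚ) = ((128 * K : ℕ) : ℚ) := by rw [hM]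
  push_cast at hM'
  rw [(e2m3e2m1Law_constants φ.manBits).1, hM', div_eq_div_iff (by norm_num) (by norm_num)]
  ring

/-- `θ_p > 0`. [cell] -/
theorem thetaL4_pos (mb : ℕ) : 0 < e2m3e2m1Law.thetaL mb := by
  rw [(e2m3e2m1Law_constants mb).1]; positivity

/-- `κ_p ≥ 0`. [cell] -/
theorem kappaL4_nonneg (mb : ℕ) : 0 ≤ e2m3e2m1Law.kappaL mb := by
  rw [(e2m3e2m1Law_constants mb).2.1]; positivity

/-! ### The sandwich -/

/-- SUP SIDE FOR EVERY `p ≥ 10` AND EVERY `n = m + 1` (kernel: the generated law certificate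
`thetaCert_e2m3e2m1Law`): `W_φ(n) ≤ 1 - θ_p/(m + θ_p(1 + 95/2 + κ_p))`.
[cell, gemm.tex Thm. t:thetapmix] -/
theorem worst4P_le (φ : Format) (hm : 9 ≤ φ.manBits) (hq : φ.qexp ≤ -4)
    (hR : (2 : ℚ) ^ (φ.manBits + 12) ≤ φ.maxRat) (m : ℕ) :
    worstRelErrMixA φ m ≤ 1 - e2m3e2m1Law.thetaL φ.manBits /
      ((m : ℚ) + e2m3e2m1Law.thetaL φ.manBits * (1 + (95 / 2 + e2m3e2m1Law.kappaL φ.manBits))) := by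
  have hθ := thetaL4_pos φ.manBits
  have hκ := kappaL4_nonneg φ.manBits
  apply sup'_le
  intro w _
  unfold relErr
  have hc : (0 : ℚ) ≤ 1 - e2m3e2m1Law.thetaL φ.manBits /
      ((m : ℚ) + e2m3e2m1Law.thetaL φ.manBits * (1 + (95 / 2 + e2m3e2m1Law.kappaL φ.manBits))) := by
    rw [sub_nonneg, div_le_one (by positivity)]
    nlinarith [show (0 : ℚ) ≤ m from Nat.cast_nonneg m]
  by_cases hL : ∑ j ∈ range (m + 1), |wordInputMixA w j| = 0
  · rw [hL, div_zero]; exact hc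
  · have hpos : 0 < ∑ j ∈ range (m + 1), |wordInputMixA w j| :=
      lt_of_le_of_ne (sum_nonneg fun i _ => abs_nonneg _) (Ne.symm hL)
    rw [div_le_iff₀ hpos]
    have h := (thetaCert_e2m3e2m1Law φ hm hq hR).abs_err_le (fun q hq' => PiL_neg _ _ hq') _
      (fun j => wordInputMixA_mem w j) m
    rw [(e2m3e2m1Law_constants φ.manBits).2.2.1, (e2m3e2m1Law_constants φ.manBits).2.2.2,
      max_eq_right (by norm_num : (31 / 2 : ℚ) ≤ 95 / 2)] at h
    exact h

/-- THE FAMILY SIDE FOR EVERY `n = m + 1 ≥ 1089K + 1` (file LIII, `K = 2^(p-8)`, every `p ≥ 8`):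
`1 - W_φ(n) ≤ (184K + 2)/(30n - 28482K + 3) = θ_p/(n - c_p)`.
[cell, gemm.tex Thm. t:thetapmix] -/
theorem one_sub_worst4P_le (φ : Format) (hq : φ.qexp ≤ -4)
    (hR : (2 : ℚ) ^ (φ.manBits + 12) ≤ φ.maxRat) {K : ℕ} (hM : 2 ^ φ.manBits = 128 * K)
    (m : ℕ) (hmK : 1089 * K ≤ m) :
    1 - worstRelErrMixA φ m
      ≤ (184 * (K : ℚ) + 2) / (30 * ((m : ℚ) + 1) - 28482 * K + 3) := by
  have hw := relErr_le_worst4P φ (fam4 K) (fam4_mem K) m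
  have hd := fam4_defect hq hR hM m hmK
  unfold relErr at hw
  linarith

/-- THE TWO-SIDED SANDWICH FOR EVERY PRECISION `p ≥ 10` AND EVERY `n ≥ 1089·2^(p-8) + 1`
(`n = m + 1`, `K = 2^(p-8)`, `θ_p = (184K + 2)/30`, `κ_p = 256/(15·2^manBits + 16)`):
`θ_p/(m + θ_p(1 + 95/2 + κ_p)) ≤ 1 - W_p(n) ≤ θ_p/(n - (28482K - 3)/30)`, both sides
kernel-checked. [cell, gemm.tex Thm. t:thetapmix] -/
theorem worst4P_sandwich (φ : Format) (hm : 9 ≤ φ.manBits) (hq : φ.qexp ≤ -4)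
    (hR : (2 : ℚ) ^ (φ.manBits + 12) ≤ φ.maxRat) {K : ℕ} (hM : 2 ^ φ.manBits = 128 * K)
    (m : ℕ) (hmK : 1089 * K ≤ m) :
    e2m3e2m1Law.thetaL φ.manBits /
        ((m : ℚ) + e2m3e2m1Law.thetaL φ.manBits * (1 + (95 / 2 + e2m3e2m1Law.kappaL φ.manBits)))
        ≤ 1 - worstRelErrMixA φ m ∧
      1 - worstRelErrMixA φ m
        ≤ e2m3e2m1Law.thetaL φ.manBits / ((m + 1 : ℚ) - (28482 * K - 3) / 30) := by
  refine ⟨by linarith [worst4P_le φ hm hq hR m], ?_⟩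
  have h := one_sub_worst4P_le φ hq hR hM m hmK
  have eB : (m + 1 : ℚ) - (28482 * K - 3) / 30
      = (30 * ((m : ℚ) + 1) - 28482 * K + 3) / 30 := by
    ring
  rw [thetaL4_eq hM, eB, div_div_div_cancel_right₀ (by norm_num : (30 : ℚ) ≠ 0)]
  exact h

/-- THE LIMIT, EVERY PRECISION `p ≥ 10`: `n · (1 - W_p(n)) → θ_p` as `n → ∞` (squeezed
between the two sides of `worst4P_sandwich`). [cell, gemm.tex Thm. t:thetapmix] -/
theorem worst4P_tendsto (φ : Format) (hm : 9 ≤ φ.manBits) (hq : φ.qexp ≤ -4)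
    (hR : (2 : ℚ) ^ (φ.manBits + 12) ≤ φ.maxRat) :
    Filter.Tendsto (fun m : ℕ => ((m : ℝ) + 1) * (1 - (worstRelErrMixA φ m : ℝ)))
      Filter.atTop (nhds (e2m3e2m1Law.thetaL φ.manBits : ℝ)) := by
  obtain ⟨K, hM⟩ : ∃ K, 2 ^ φ.manBits = 128 * K :=
    ⟨2 ^ (φ.manBits - 7), by
      rw [show (128 : ℕ) = 2 ^ 7 by norm_num, ← pow_add, Nat.add_sub_cancel' (by omega)]⟩
  set θ : ℝ := (e2m3e2m1Law.thetaL φ.manBits : ℝ) with hθdef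
  set a : ℝ := θ * (1 + (95 / 2 + (e2m3e2m1Law.kappaL φ.manBits : ℝ))) - 1 with hadef
  set b : ℝ := (28482 * (K : ℝ) - 3) / 30 with hbdef
  have hlim0 : Filter.Tendsto (fun m : ℕ => 1 / ((m : ℝ) + 1)) Filter.atTop (nhds 0) :=
    tendsto_one_div_add_atTop_nhds_zero_nat
  have hg : Filter.Tendsto (fun m : ℕ => θ / (1 + a * (1 / ((m : ℝ) + 1)))) Filter.atTop
      (nhds θ) := by
    have h : Filter.Tendsto (fun m : ℕ => θ / (1 + a * (1 / ((m : ℝ) + 1)))) Filter.atTop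
        (nhds (θ / (1 + a * 0))) :=
      tendsto_const_nhds.div (tendsto_const_nhds.add (tendsto_const_nhds.mul hlim0))
        (by norm_num)
    rw [mul_zero, add_zero, div_one] at h
    exact h
  have hh : Filter.Tendsto (fun m : ℕ => θ / (1 - b * (1 / ((m : ℝ) + 1)))) Filter.atTop
      (nhds θ) := by
    have h : Filter.Tendsto (fun m : ℕ => θ / (1 - b * (1 / ((m : ℝ) + 1)))) Filter.atTop
        (nhds (θ / (1 - b * 0))) :=
      tendsto_const_nhds.div (tendsto_const_nhds.sub (tendsto_const_nhds.mul hlim0))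
        (by norm_num)
    rw [mul_zero, sub_zero, div_one] at h
    exact h
  refine tendsto_of_tendsto_of_tendsto_of_le_of_le' hg hh ?_ ?_
  · refine Filter.eventually_atTop.2 ⟨1089 * K, fun m hmK => ?_⟩
    have hr1 := (Rat.cast_le (K := ℝ)).mpr (worst4P_sandwich φ hm hq hR hM m hmK).1
    push_cast at hr1
    have hm0 : (0 : ℝ) < (m : ℝ) + 1 := by positivity
    have hm1 : (m : ℝ) + 1 ≠ 0 := hm0.ne'
    have e1 : 1 + a * (1 / ((m : ℝ) + 1)) = (((m : ℝ) + 1) + a) / ((m : ℝ) + 1) := by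
      rw [eq_div_iff hm1, add_mul, one_mul, mul_assoc, one_div_mul_cancel hm1, mul_one]
    have e2 : ((m : ℝ) + 1) + a
        = (m : ℝ) + θ * (1 + (95 / 2 + (e2m3e2m1Law.kappaL φ.manBits : ℝ))) := by
      rw [hadef]; ring
    show θ / (1 + a * (1 / ((m : ℝ) + 1))) ≤ ((m : ℝ) + 1) * (1 - (worstRelErrMixA φ m : ℝ))
    rw [e1, div_div_eq_mul_div, e2]
    calc θ * ((m : ℝ) + 1) / ((m : ℝ) + θ * (1 + (95 / 2 + (e2m3e2m1Law.kappaL φ.manBits : ℝ))))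
        = ((m : ℝ) + 1) *
            (θ / ((m : ℝ) + θ * (1 + (95 / 2 + (e2m3e2m1Law.kappaL φ.manBits : ℝ))))) := by ring
      _ ≤ ((m : ℝ) + 1) * (1 - (worstRelErrMixA φ m : ℝ)) :=
          mul_le_mul_of_nonneg_left hr1 hm0.le
  · refine Filter.eventually_atTop.2 ⟨1089 * K, fun m hmK => ?_⟩
    have hr2 := (Rat.cast_le (K := ℝ)).mpr (worst4P_sandwich φ hm hq hR hM m hmK).2
    push_cast at hr2
    have hm0 : (0 : ℝ) < (m : ℝ) + 1 := by positivity
    have hm1 : (m : ℝ) + 1 ≠ 0 := hm0.ne'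
    have e1 : 1 - b * (1 / ((m : ℝ) + 1)) = (((m : ℝ) + 1) - b) / ((m : ℝ) + 1) := by
      rw [eq_div_iff hm1, sub_mul, one_mul, mul_assoc, one_div_mul_cancel hm1, mul_one]
    show ((m : ℝ) + 1) * (1 - (worstRelErrMixA φ m : ℝ))
      ≤ θ / (1 - b * (1 / ((m : ℝ) + 1)))
    rw [e1, div_div_eq_mul_div, hbdef]
    calc ((m : ℝ) + 1) * (1 - (worstRelErrMixA φ m : ℝ))
        ≤ ((m : ℝ) + 1) * (θ / (((m : ℝ) + 1) - (28482 * (K : ℝ) - 3) / 30)) :=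
          mul_le_mul_of_nonneg_left hr2 hm0.le
      _ = θ * ((m : ℝ) + 1) / (((m : ℝ) + 1) - (28482 * (K : ℝ) - 3) / 30) := by ring

/-! ### The instance `p = 24` (binary32) in integers -/

/-- binary32 meets the hypotheses, with `K = 2^16 = 65536`. [cite: IEEE7542019, Table 3.5] -/
theorem Binary32_hyps4 : 9 ≤ Format.Binary32.manBits ∧ Format.Binary32.qexp ≤ -4 ∧
    (2 : ℚ) ^ (Format.Binary32.manBits + 12) ≤ Format.Binary32.maxRat ∧
    2 ^ Format.Binary32.manBits = 128 * 65536 := by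
  obtain ⟨h1, h2, h3⟩ := Binary32_gen_hyps
  refine ⟨by rw [h1]; norm_num, le_trans h2 (by norm_num), le_trans ?_ h3, by rw [h1]; norm_num⟩
  rw [h1]; norm_num

/-- E2M3·E2M1 INTO binary32, EVERY `n ≥ 71368705 = 1089·2^16 + 1`:
`31610968560982/(78643210n + 1533131960877089) ≤ 1 - W_24(n) ≤ 4019542/(10n - 622198783)`;
the left side holds for every `n` (the law's envelope `abs_dot_err_le_e2m3e2m1_Binary32`), the
right side is the family; `θ_24 = 2009771/5` and `n(1 - W_24(n)) → θ_24`.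
[cell, gemm.tex Thm. t:thetapmix at p = 24] -/
theorem worst4P_sandwich_Binary32 (m : ℕ) (hm : 71368704 ≤ m) :
    31610968560982 / (78643210 * ((m : ℚ) + 1) + 1533131960877089)
        ≤ 1 - worstRelErrMixA Format.Binary32 m ∧
      1 - worstRelErrMixA Format.Binary32 m ≤ 4019542 / (10 * ((m : ℚ) + 1) - 622198783) := by
  obtain ⟨h1, h2, h3, h4⟩ := Binary32_hyps4
  have h := worst4P_sandwich Format.Binary32 h1 h2 h3 h4 m (by omega)
  rw [Binary32_gen_hyps.1, lawConstants_Binary32.2.2.2.2.1,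
    lawConstants_Binary32.2.2.2.2.2.1] at h
  have hm' : (71368704 : ℚ) ≤ m := by exact_mod_cast hm
  have e1 : (2009771 / 5 : ℚ) / ((m : ℚ) + 2009771 / 5 * (1 + (95 / 2 + 16 / 7864321)))
      = 31610968560982 / (78643210 * ((m : ℚ) + 1) + 1533131960877089) := by
    rw [div_eq_div_iff (by positivity) (by positivity)]; ring
  have e2 : (2009771 / 5 : ℚ) / ((m + 1 : ℚ) - (28482 * ((65536 : ℕ) : ℚ) - 3) / 30)
      = 4019542 / (10 * ((m : ℚ) + 1) - 622198783) := by
    rw [div_eq_div_iff (ne_of_gt (by push_cast; linarith)) (ne_of_gt (by linarith))]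
    push_cast; ring
  rw [e1, e2] at h
  exact h

end Summit.Ventures.CertifiedArithmetic.LowPrec.Gemm
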